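import Mathlib
import Literature.MathematicalPhysics.QuantumFieldTheory.Borinsky2020.TropicalApproximation
import HarnessLib

/-!
# Borinsky's tropical approximation theorem, the hard half: a completely non-vanishing polynomial is bounded BELOW by a constant times its tropical approximation (AIHPD 2023 = arXiv:2008.12310, §3: Theorem 8b, with Proposition 7, Lemmas 10–11 and the printed converse) — PROVED

independent recomputation; certified where stated, statistical where stated; no new-physics claim.

CITATION HEADER (venture `QEDPrecision`, cell `pub-qed`, track TROPICAL, LIT seat `pub-qed-trop-lit` gen 24; VALUE-FREE: inequalities
about ABSTRACT polynomials only — no Feynman graph, no integral, no Monte-Carlo value, nothing per word or per Set V family). Completes the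
companion file `Borinsky2020/TropicalApproximation.lean` (Definitions 1, 2, 6, Theorem 8a, the positive-coefficient case of 8b; its header:
"NOT typed: Theorem 8b in general"), whose definitions `monom`, `trop`, `pairing`, `faceValue`, `trunc`, `CompletelyNonVanishing` are used
verbatim here. Serves: the track's source sheet `tropical/lit/SOURCES.md` §1.3 / A23 (the charge names "Borinsky 2020 … tropical
approximation theorem … AS PRINTED"); `Volkov2016/RayConvergenceCriterion.lean` §1 (its `integrableOn_of_le_tropMax_div` is "usable with ANY
denominator bounded below by a constant times its tropical maximum — positive coefficients as printed, or e.g. a completely non-vanishing one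
… Thm 8b there": this file supplies that bound); ORACLE-MAP §0b clause (i) ("completely non-vanishing denominators", requirement R3 of
Theorem 3) and T2's cancelling-face question (the converse below is the printed statement that a truncation with a positive zero DEFEATS
every lower bound `C·p^tr ≤ |p|`).

Source [Borinsky2020]: M. Borinsky, "Tropical Monte Carlo quadrature for Feynman integrals", Ann. Inst. Henri Poincaré D 10 (2023) 635–685,
doi:10.4171/aihpd/158 = arXiv:2008.12310v2 (LaTeX e-print held by the cell, HOME `data/lit/sources/.cache/2008.12310/tropical.tex`; theorem
numbers = the e-print's single shared counter as in the companion files; e-print §3 = journal §3). VERBATIM. Proposition 7 (tex l.425–428):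
"p^tr(e^y) = e^{max_{v∈NP_p} ⟨y,v⟩}, where we used the notation e^y = (e^{y_1}, …, e^{y_n}) to denote the component-wise exponential." with
eq. (logPtr) (l.419): "log p^tr(x) = max_{ℓ∈supp(p)} log x^ℓ = max_{ℓ∈supp(p)} Σ_k y_k ℓ_k = max_{ℓ∈supp(p)} ⟨y,ℓ⟩ = max_{v∈NP_p} ⟨y,v⟩".
**Theorem 8b** (l.455–459): "If p ∈ ℂ[x_1,…,x_n] is completely non-vanishing on ℝ^n_{>0}, then there is a constant C > 0 such that
C p^tr(x) ≤ |p(x)| for all x ∈ ℝ^n_{>0}." Corollary 9 (l.463–471, homogeneous p on ℙ^{n−1}_{>0}) with "Inequalities as the one above, which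
can be written as quotients of homogeneous objects, shall be interpreted accordingly, in this obvious sense as statements on these quotients."
§3.2 (l.477–478): "Theorem 8b is substantially harder to prove than Theorem 8a. … For such a lower bound to exist it is not necessary for the
polynomial to have only positive coefficients; it is sufficient for the polynomial to be completely non-vanishing. In fact, the existence of
such a lower bound is also necessary for a polynomial to be completely non-vanishing, which can be proven using a similar argument as in the
proof of Theorem 8b below." eq. (normal_cone) (l.486): "𝒞_F = {y ∈ ℝ^n : ⟨y,v⟩ = max_{w∈𝒫} ⟨y,w⟩ for all v ∈ F}". **Lemma 10** (l.520–527):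
"For each face F of the Newton polytope NP_p of a polynomial p, the truncated polynomial p_F fulfills p_F(e^{s+t}) = p^tr(e^s) p_F(e^t) for all
s ∈ 𝒞_F and t ∈ ℝ^n." **Lemma 11** (l.529–535): "p^tr(e^{s+t}) ≤ p^tr(e^s) p^tr(e^t) for all s, t ∈ ℝ^n." Lemma 12 (l.564–571, the margin
`max_{v∈𝒫}⟨y,v⟩ − ⟨y,k⟩ ≥ C R` on the modified cones), **Proposition 13** (l.591–597: "If p … is completely non-vanishing on ℝ^n_{>0} and
R ≥ 0, then there is a constant C > 0 such that C p^tr(e^{s+t}) ≤ |p(e^{s+t})| for all s ∈ 𝒞_F and t ∈ B_R for each face F ⊂ NP_p", proved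
"by induction in the codimension of F"), proof of Theorem 8b (l.641–643): "Use Proposition 13 and the completeness of the normal fan.", and
Remark 14 (l.645–647): "we actually constructed explicit bounds for the constants in Theorem 8 … we will not make use of them in this article."
Source [SturmfelsTelek2025]: B. Sturmfels, M. L. Telek, "Copositive geometry of Feynman integrals", Lett. Math. Phys. 115 (2025),
doi:10.1007/s11005-025-01961-w = arXiv:2504.01628 (held, `lit read arxiv:2504.01628`, chunks p0006 / p0011), §2 after Theorem 2.2 (their
restatement of Borinsky's Theorem 3): "the denominator polynomial 𝓕_z must be strictly copositive. In [Borinsky] and other sources, this is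
phrased as saying that 𝓕_z is completely non-vanishing on ℙ^{n−1}_{>0}."; **Lemma 5.3**: "The interior of the copositive cone 𝒞_𝒜 consists
of all polynomials f ∈ ℝ[𝒜] such that, for each face Q of P, the inequality f|_Q(u) > 0 holds for all u in the open orthant ℝ^n_{>0}." with
the proof "We consider the decomposition of X_𝒜 into torus orbits. There is one orbit for each face Q of P, and this orbit is parametrized by
monomials x^a where a ranges over 𝒜 ∩ Q. The nonnegative toric variety X_{𝒜,≥0} is the disjoint union of the sets of strictly positive points
in each orbit."; Lemma 5.1 (proof): "The nonnegative toric variety X_{𝒜,≥0} is a compact semialgebraic subset of the simplex".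

PROOF ROUTE (disclosed deviation). The STATEMENT typed is Theorem 8b as printed (existence of C > 0). The printed PROOF — Lemma 12's explicit
margin on the modified cones 𝒞̃_F and Proposition 13's induction on the codimension of F, giving the explicit constants of Remark 14 — needs
the face lattice and the normal fan of a polytope with dimension counts, which Mathlib does not have; it is replaced here by the compactness
form of the same geometry, i.e. the torus-orbit reading printed in [SturmfelsTelek2025] Lemma 5.1 / 5.3: if no C works, pick x_m ∈ ℝ^n_{>0}
with |p(x_m)|/p^tr(x_m) → 0; the NORMALISED MONOMIAL VECTORS w_m = (x_m^ℓ / p^tr(x_m))_{ℓ∈supp(p)} ∈ [0,1]^{supp(p)} (a point of the positive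
torus in the coordinates of X_𝒜, scaled to max = 1) have a convergent subsequence (Bolzano–Weierstrass), the limit w has max_ℓ w_ℓ = 1 and
Σ_ℓ c_ℓ w_ℓ = 0; in logarithmic coordinates y = log x (Proposition 7: log w_{m,ℓ} = ⟨y_m,ℓ⟩ − max_{ℓ'}⟨y_m,ℓ'⟩, an affine functional of ℓ)
finite-dimensional linear algebra shows that the support F = {ℓ : w_ℓ > 0} of the limit is EXACTLY the set of maximisers of some functional
⟨y,·⟩ on supp(p) — a face F_y of NP_p in the sense of Definition 1 — and that (w_ℓ)_{ℓ∈F} = (e^{⟨t,ℓ⟩ − c})_{ℓ∈F} is a positive point of that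
face's torus orbit (closedness of the finite-dimensional space of affine functionals restricted to F; a linear right inverse of the
restriction map to push the off-face coordinates to −∞ while keeping the face coordinates fixed — the role Lemma 12's margin plays in print);
hence p_{F_y}(e^t) = e^{−c}·Σ_ℓ c_ℓ w_ℓ = 0 at a point of ℝ^n_{>0}, contradicting complete non-vanishing. Lemma 10 and Proposition 7 enter in
the printed roles (homogeneity of p_F along its normal directions; p^tr in exponential form); Lemma 11 is typed for completeness (it is used in
print only inside Proposition 13). The explicit constants of Remark 14 are NOT typed. The converse (l.478, "can be proven using a similar
argument") is proved as print indicates: if p_{F_y}(x₀) = 0 with x₀ = e^t ∈ ℝ^n_{>0}, then along the ray x_λ = e^{t+λy}, λ → ∞, Lemma 10 kills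
the face part, the other monomials are smaller by e^{−λδ} (δ = the gap of ⟨y,·⟩ below its maximum on supp(p)), while p^tr(x_λ) ≥ e^{⟨t,ℓ₁⟩+λ·max},
so |p(x_λ)|/p^tr(x_λ) → 0 and no C > 0 exists.

TYPING (as in the companion file). Real coefficients (`MvPolynomial σ ℝ`; the paper allows ℂ — TODO(general form): `MvPolynomial σ ℂ` with
`‖·‖`, same proofs); arbitrary index type `σ` (only the finitely many variables of `p` matter); points `x : σ → ℝ` with the hypothesis
`∀ i, 0 < x i` (= ℝ^n_{>0}); faces through their exposing functional `y : σ → ℝ` (`trunc p y`, `faceValue p y`; every face of a polytope is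
exposed, l.291); "s ∈ 𝒞_F" for F = F_y is typed literally after eq. (normal_cone): `∀ d ∈ p.support, pairing y d = faceValue p y →
pairing s d = faceValue p s` (s is maximal on every vertex of F). Corollary 9 needs no separate statement in this affine typing: for
homogeneous p the inequality of Theorem 8 on ℝ^n_{>0} IS the printed statement about the quotient |p|/p^tr on ℙ^{n−1}_{>0}.
JUNK VALUES: `trop 0 = 0`, `faceValue 0 = 0` (companion file); `CompletelyNonVanishing 0 X` is false for non-empty X, so Theorem 8b's
hypothesis forces `p ≠ 0`, while the converse carries `p ≠ 0` explicitly (for p = 0 the bound `C·0 ≤ |0|` holds vacuously).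

PROVED (0 named facts, D-0026; Mathlib + the companion file only):
* `monom_exp` (x^ℓ = e^{⟨y,ℓ⟩} at x = e^y), `pairing_add_smul`, `pairing_le_faceValue`, `exists_pairing_eq_faceValue`,
  **`trop_exp`** = Proposition 7 (p^tr(e^y) = e^{faceValue p y} = e^{max_{ℓ∈supp p}⟨y,ℓ⟩});
* **`eval_trunc_exp_add`** = Lemma 10 (p_F(e^{s+t}) = e^{max⟨s,·⟩} p_F(e^t) for s ∈ 𝒞_F) and `eval_trunc_exp_add_self` (s = y: the factor is
  p^tr(e^y)); **`trop_mul_le`** = Lemma 11 in multiplicative coordinates (p^tr(x·x') ≤ p^tr(x) p^tr(x') on the closed orthant);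
* **`exists_pos_mul_trop_le_abs_eval`** = THEOREM 8b: `CompletelyNonVanishing p {x | ∀ i, 0 < x i} → ∃ C, 0 < C ∧ ∀ x, (∀ i, 0 < x i) →
  C * trop p x ≤ |eval x p|`;
* **`completelyNonVanishing_of_exists_pos_mul_trop_le`** = the printed converse (l.478), and the packaging
  **`completelyNonVanishing_iff_exists_pos_mul_trop_le`** (p ≠ 0): completely non-vanishing on ℝ^n_{>0} ⟺ ∃ C > 0, C·p^tr ≤ |p| on ℝ^n_{>0}
  (= [SturmfelsTelek2025] Lemma 5.3's "strictly positive on X_{𝒜,≥0}" read through |p|/p^tr, for either sign);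
* `exists_two_sided_trop_bound` = Theorem 8 both halves under complete non-vanishing (C₁ p^tr ≤ |p| ≤ C₂ p^tr, C₂ = Σ|c_ℓ| + 1 from Theorem 8a).
* **`exists_abs_residual_le`** = the sentence of Theorem 3's proof that uses Theorem 8 (l.857: "Corollary 9 implies that |R_{a/b}(x)| is
  bounded on ℙ^{n−1}_{>0}") = Proposition 20's hypothesis: for finitely many numerators a_i (any) and denominators b_j (each completely
  non-vanishing on ℝ^n_{>0}, R3) and real exponents ν_i, ρ_j ≥ 0, the modulus of eq. (def_residualab)'s residual
  (Π_i |a_i|^{ν_i}/(a_i^tr)^{ν_i})/(Π_j |b_j|^{ρ_j}/(b_j^tr)^{ρ_j}) is bounded on ℝ^n_{>0} (with `abs_eval_rpow_div_trop_rpow_le`, Theorem 8a to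
  the power ν, and `rpow_le_abs_eval_rpow_div_trop_rpow`, Theorem 8b to the power ρ, per factor) — the companion
  `TropicalSamplingEstimator.lean` takes exactly such a bound `|R| ≤ C` as hypothesis and records it as not typed there.
NOT typed: the explicit constants (Lemma 12, Remark 14); normal fans / face lattices as objects (§3.3 first paragraph); Theorem 3 and §4–§7
(Theorem 3's proof combines this file with `ConeIntegral` / `HeppSectorDecomposition` / `HeppSectorConvergence` — not assembled here);
complex coefficients; [SturmfelsTelek2025]'s copositive cone 𝒞_𝒜, principal 𝒜-determinant (Thm 5.4) and Pólya certificates (§6).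
-/

noncomputable section

open MvPolynomial Finset Filter Topology Real

namespace Literature.MathematicalPhysics.QuantumFieldTheory.Borinsky2020

variable {σ : Type*}

/-! ### Monomials, faces and `p^tr` in logarithmic coordinates (Proposition 7) -/

/-- `x^ℓ > 0` on the open positive orthant. [folklore] -/
private theorem monom_pos'' {x : σ → ℝ} (hx : ∀ i, 0 < x i) (d : σ →₀ ℕ) : 0 < monom d x :=
  Finset.prod_pos fun i _ => pow_pos (hx i) _

/-- `x^ℓ ≥ 0` on the closed positive orthant. [folklore] -/
private theorem monom_nonneg'' {x : σ → ℝ} (hx : ∀ i, 0 ≤ x i) (d : σ →₀ ℕ) : 0 ≤ monom d x :=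
  Finset.prod_nonneg fun i _ => pow_nonneg (hx i) _

/-- In logarithmic coordinates `x = e^y` a monomial is the exponential of the pairing: `x^ℓ = e^{Σ_k y_k ℓ_k} = e^{⟨y,ℓ⟩}`
("change to logarithmic coordinates y_k = log x_k … log x^ℓ = Σ_{k=1}^n y_k ℓ_k = ⟨y,ℓ⟩").
[cite: Borinsky2020, eq. (logPtr) (tropical.tex l.417–419)] -/
theorem monom_exp (d : σ →₀ ℕ) (y : σ → ℝ) : monom d (fun i => exp (y i)) = exp (pairing y d) := by
  rw [monom, pairing, Real.exp_sum]
  refine Finset.prod_congr rfl fun i _ => ?_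
  rw [mul_comm, Real.exp_nat_mul]

/-- `⟨t + r·y, ℓ⟩ = ⟨t,ℓ⟩ + r⟨y,ℓ⟩`: bilinearity of the pairing `⟨v, w⟩ = Σ_{k=1}^n v_k w_k` ("we will identify the space of linear forms on
ℝⁿ with ℝⁿ via the usual scalar product"). [cite: Borinsky2020, §2 (tropical.tex l.291)] -/
theorem pairing_add_smul (t y : σ → ℝ) (r : ℝ) (d : σ →₀ ℕ) :
    pairing (fun i => t i + r * y i) d = pairing t d + r * pairing y d := by
  simp only [pairing, add_mul, Finset.sum_add_distrib, mul_assoc, Finset.mul_sum]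

/-- Unfolding of `faceValue` for `p ≠ 0`: the maximum of `⟨y,·⟩` over `supp(p)`. [cite: Borinsky2020, §2 (tropical.tex l.291)] -/
theorem faceValue_of_ne_zero {p : MvPolynomial σ ℝ} (hp : p ≠ 0) (y : σ → ℝ) :
    faceValue p y = p.support.sup' (support_nonempty.mpr hp) (pairing y) := by
  simp [faceValue, support_nonempty.mpr hp]

/-- Unfolding of `trop` for `p ≠ 0` (Definition 6: the maximum of the monomials of the support).
[cite: Borinsky2020, Definition 6 (tropical.tex l.399–403)] -/
theorem trop_of_ne_zero {p : MvPolynomial σ ℝ} (hp : p ≠ 0) (x : σ → ℝ) :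
    trop p x = p.support.sup' (support_nonempty.mpr hp) (fun d => monom d x) := by
  simp [trop, support_nonempty.mpr hp]

/-- Every exponent of the support pairs to at most the face value: `⟨y,ℓ⟩ ≤ max_{ℓ'∈supp(p)} ⟨y,ℓ'⟩`.
[cite: Borinsky2020, §2 (tropical.tex l.291)] -/
theorem pairing_le_faceValue {p : MvPolynomial σ ℝ} {d : σ →₀ ℕ} (hd : d ∈ p.support) (y : σ → ℝ) :
    pairing y d ≤ faceValue p y := by
  have h : p.support.Nonempty := ⟨d, hd⟩
  simp only [faceValue, h, ↓reduceDIte]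
  exact Finset.le_sup' (pairing y) hd

/-- The face `F_y` is non-empty: some exponent of the support attains the face value ("a face of a polytope is a subset of 𝒫 which
maximizes a given linear functional y"). [cite: Borinsky2020, §2 (tropical.tex l.291)] -/
theorem exists_pairing_eq_faceValue {p : MvPolynomial σ ℝ} (hp : p ≠ 0) (y : σ → ℝ) :
    ∃ d ∈ p.support, pairing y d = faceValue p y := by
  obtain ⟨d, hd, h⟩ := Finset.exists_mem_eq_sup' (support_nonempty.mpr hp) (pairing y)
  exact ⟨d, hd, by rw [faceValue_of_ne_zero hp, h]⟩

/-- **Proposition 7**: `p^tr(e^y) = e^{max_{ℓ∈supp(p)} ⟨y,ℓ⟩}` (= `e^{max_{v∈NP_p}⟨y,v⟩}`, the support function of the Newton polytope,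
which on the finite set `supp(p)` is the typed `faceValue p y`). [cite: Borinsky2020, Proposition 7 (tropical.tex l.425–428); eq. (logPtr) (l.419)] -/
theorem trop_exp {p : MvPolynomial σ ℝ} (hp : p ≠ 0) (y : σ → ℝ) :
    trop p (fun i => exp (y i)) = exp (faceValue p y) := by
  have hS : p.support.Nonempty := support_nonempty.mpr hp
  rw [trop_of_ne_zero hp, faceValue_of_ne_zero hp,
    Finset.apply_sup'_eq_sup'_comp hS Real.exp (fun a b => Real.exp_monotone.map_sup a b)]
  simp only [Function.comp_def, monom_exp]

/-! ### Lemma 10 (homogeneity of the truncation along its normal cone) and Lemma 11 (submultiplicativity) -/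

/-- **Lemma 10**: for the face `F = F_y` and every `s` in its normal cone `𝒞_F` (typed after eq. (normal_cone): `⟨s,·⟩` attains its maximum over
`supp(p)` at every exponent of `F`) and every `t`, `p_F(e^{s+t}) = e^{max⟨s,·⟩} · p_F(e^t)` (and `e^{max⟨s,·⟩} = p^tr(e^s)` by Proposition 7).
[cite: Borinsky2020, Lemma 10 (tropical.tex l.520–527); eq. (normal_cone) (l.486)] -/
theorem eval_trunc_exp_add {p : MvPolynomial σ ℝ} (y s t : σ → ℝ)
    (hs : ∀ d ∈ p.support, pairing y d = faceValue p y → pairing s d = faceValue p s) :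
    eval (fun i => exp (s i + t i)) (trunc p y) = exp (faceValue p s) * eval (fun i => exp (t i)) (trunc p y) := by
  classical
  rw [eval_trunc, eval_trunc, Finset.mul_sum]
  refine Finset.sum_congr rfl fun d hd => ?_
  obtain ⟨hdS, hdy⟩ := Finset.mem_filter.mp hd
  have hst : pairing (fun i => s i + t i) d = pairing s d + pairing t d := by
    simp only [pairing, add_mul, Finset.sum_add_distrib]
  rw [monom_exp, monom_exp, hst, hs d hdS hdy, Real.exp_add]
  ring

/-- **Lemma 10** with `s = y` itself (which lies in `𝒞_{F_y}`), in the printed form `p_F(e^{y+t}) = p^tr(e^y) p_F(e^t)`.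
[cite: Borinsky2020, Lemma 10 (tropical.tex l.520–527); Proposition 7] -/
theorem eval_trunc_exp_add_self {p : MvPolynomial σ ℝ} (hp : p ≠ 0) (y t : σ → ℝ) :
    eval (fun i => exp (y i + t i)) (trunc p y) = trop p (fun i => exp (y i)) * eval (fun i => exp (t i)) (trunc p y) := by
  rw [trop_exp hp, eval_trunc_exp_add y y t (fun _ _ h => h)]

/-- **Lemma 11** (submultiplicativity), in multiplicative coordinates `x = e^s`, `x' = e^t`: `p^tr(x·x') ≤ p^tr(x) · p^tr(x')` on the closed
positive orthant (printed: "p^tr(e^{s+t}) ≤ p^tr(e^s) p^tr(e^t) for all s, t ∈ ℝ^n").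
[cite: Borinsky2020, Lemma 11 (tropical.tex l.529–535)] -/
theorem trop_mul_le (p : MvPolynomial σ ℝ) {x x' : σ → ℝ} (hx : ∀ i, 0 ≤ x i) (hx' : ∀ i, 0 ≤ x' i) :
    trop p (fun i => x i * x' i) ≤ trop p x * trop p x' := by
  by_cases hp : p = 0
  · simp [hp, trop]
  obtain ⟨d, hd, h⟩ := exists_monom_eq_trop hp (fun i => x i * x' i)
  rw [← h]
  have hmul : monom d (fun i => x i * x' i) = monom d x * monom d x' := by
    simp only [monom, mul_pow, Finset.prod_mul_distrib]
  rw [hmul]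
  exact mul_le_mul (monom_le_trop hd x) (monom_le_trop hd x') (monom_nonneg'' hx' d)
    ((monom_nonneg'' hx d).trans (monom_le_trop hd x))

/-! ### Theorem 8b -/

/-- **Theorem 8b** (the tropical approximation property, lower bound): "If p ∈ ℂ[x_1,…,x_n] is completely non-vanishing on ℝ^n_{>0}, then
there is a constant C > 0 such that C p^tr(x) ≤ |p(x)| for all x ∈ ℝ^n_{>0}." (Real coefficients; proof by the compactness / torus-orbit
form of §3.3 — see the module docstring; the explicit constants of Remark 14 are not typed.)
[cite: Borinsky2020, Theorem 8b (tropical.tex l.455–459); Proposition 13 and proof of Theorem 8b (l.591–643)]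
[cite: SturmfelsTelek2025, Lemma 5.3 (proof: torus-orbit decomposition of X_𝒜) and Lemma 5.1] -/
theorem exists_pos_mul_trop_le_abs_eval (p : MvPolynomial σ ℝ)
    (h : CompletelyNonVanishing p {x | ∀ i, 0 < x i}) :
    ∃ C : ℝ, 0 < C ∧ ∀ x : σ → ℝ, (∀ i, 0 < x i) → C * trop p x ≤ |eval x p| := by
  classical
  -- `p ≠ 0`: the truncations of `0` vanish everywhere.
  have hp : p ≠ 0 := by
    rintro rfl
    exact h 0 (fun _ => 1) (fun _ => one_pos) (by simp [trunc])
  have hS : p.support.Nonempty := support_nonempty.mpr hp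
  -- linear-algebra scaffolding: the affine functionals `(y, c) ↦ (⟨y,ℓ⟩ + c)_{ℓ ∈ supp p}` as a linear map, and the coordinate
  -- projection onto a set of indices (only their evaluation rules are used below)
  obtain ⟨affMap, affMap_apply⟩ : ∃ A : ((σ → ℝ) × ℝ) →ₗ[ℝ] (↥p.support → ℝ),
      ∀ (y : σ → ℝ) (c : ℝ) (d : ↥p.support), A (y, c) d = pairing y d.1 + c := by
    refine ⟨LinearMap.pi fun d => (∑ i ∈ d.1.support, ((d.1 i : ℕ) : ℝ) • LinearMap.proj i).comp
      (LinearMap.fst ℝ (σ → ℝ) ℝ) + LinearMap.snd ℝ (σ → ℝ) ℝ, fun y c d => ?_⟩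
    simp only [LinearMap.pi_apply, LinearMap.add_apply, LinearMap.comp_apply, LinearMap.fst_apply,
      LinearMap.snd_apply, LinearMap.sum_apply, LinearMap.smul_apply, LinearMap.proj_apply, smul_eq_mul, pairing]
    exact congrArg (· + c) (Finset.sum_congr rfl fun i _ => mul_comm _ _)
  have projSet : ∀ F : Set ↥p.support, ∃ P : (↥p.support → ℝ) →ₗ[ℝ] (↥p.support → ℝ),
      ∀ v d, P v d = F.indicator v d := fun F =>
    ⟨{ toFun := fun v => F.indicator v
       map_add' := fun v v' => by
         ext d
         by_cases hd : d ∈ F <;> simp [hd]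
       map_smul' := fun c v => by
         ext d
         by_cases hd : d ∈ F <;> simp [hd] }, fun _ _ => rfl⟩
  by_contra hcon
  push Not at hcon
  -- a sequence `x m ∈ ℝ^n_{>0}` with `|p(x m)| < p^tr(x m)/(m+1)`
  have hseq : ∀ m : ℕ, ∃ x : σ → ℝ, (∀ i, 0 < x i) ∧ |eval x p| < (1 / ((m : ℝ) + 1)) * trop p x :=
    fun m => hcon _ (by positivity)
  choose x hxpos hxlt using hseq
  have htrop : ∀ m, 0 < trop p (x m) := fun m => trop_pos (hxpos m) hp
  -- the normalised monomial vectors `nmv m = (x_m^ℓ / p^tr(x_m))_{ℓ ∈ supp p} ∈ [0,1]^{supp p}`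
  obtain ⟨nmv, hnmv⟩ : ∃ nmv : ℕ → (↥p.support → ℝ), ∀ m d, nmv m d = monom d.1 (x m) / trop p (x m) :=
    ⟨_, fun _ _ => rfl⟩
  have hnmv0 : ∀ m d, 0 ≤ nmv m d := fun m d => by
    rw [hnmv]; exact div_nonneg (monom_nonneg'' (fun i => (hxpos m i).le) _) (htrop m).le
  have hnmv1 : ∀ m d, nmv m d ≤ 1 := fun m d => by
    rw [hnmv]; exact (div_le_one (htrop m)).mpr (monom_le_trop d.2 _)
  have hnmvpos : ∀ m d, 0 < nmv m d := fun m d => by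
    rw [hnmv]; exact div_pos (monom_pos'' (hxpos m) _) (htrop m)
  -- Bolzano–Weierstrass in `ℝ^{supp p}`
  obtain ⟨w, hwmem, φ, hφ, hw⟩ := tendsto_subseq_of_bounded (Metric.isBounded_Icc (0 : ↥p.support → ℝ) 1)
    (x := nmv) (fun m => ⟨fun d => hnmv0 m d, fun d => hnmv1 m d⟩)
  rw [isClosed_Icc.closure_eq] at hwmem
  have hw0 : ∀ d, 0 ≤ w d := fun d => hwmem.1 d
  have hwd : ∀ d, Tendsto (fun m => nmv (φ m) d) atTop (𝓝 (w d)) := fun d => tendsto_pi_nhds.mp hw d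
  -- (a) the limit is a zero of the coefficient functional: `Σ_ℓ c_ℓ w_ℓ = 0`
  have hsum_nmv : ∀ m, ∑ d : ↥p.support, p.coeff d.1 * nmv m d = eval (x m) p / trop p (x m) := by
    intro m
    simp only [hnmv]
    rw [Finset.sum_coe_sort p.support (fun d => p.coeff d * (monom d (x m) / trop p (x m))),
      eval_eq_sum_coeff_mul_monom, Finset.sum_div]
    exact Finset.sum_congr rfl fun d _ => (mul_div_assoc _ _ _).symm
  have hquot : Tendsto (fun m => eval (x (φ m)) p / trop p (x (φ m))) atTop (𝓝 0) := by
    have hb : ∀ m, ‖eval (x (φ m)) p / trop p (x (φ m))‖ ≤ 1 / ((m : ℝ) + 1) := by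
      intro m
      rw [Real.norm_eq_abs, abs_div, abs_of_pos (htrop _), div_le_iff₀ (htrop _)]
      refine (hxlt (φ m)).le.trans (mul_le_mul_of_nonneg_right ?_ (htrop _).le)
      exact one_div_le_one_div_of_le (by positivity) (by exact_mod_cast Nat.succ_le_succ (hφ.id_le m))
    exact squeeze_zero_norm hb tendsto_one_div_add_atTop_nhds_zero_nat
  have hsumw : ∑ d : ↥p.support, p.coeff d.1 * w d = 0 := by
    have h1 : Tendsto (fun m => ∑ d : ↥p.support, p.coeff d.1 * nmv (φ m) d) atTop
        (𝓝 (∑ d : ↥p.support, p.coeff d.1 * w d)) :=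
      tendsto_finsetSum _ fun d _ => (hwd d).const_mul _
    have h2 : Tendsto (fun m => ∑ d : ↥p.support, p.coeff d.1 * nmv (φ m) d) atTop (𝓝 0) := by
      simp only [hsum_nmv]; exact hquot
    exact tendsto_nhds_unique h1 h2
  -- (b) the limit has a coordinate equal to `1` (the maximal monomial): `max_ℓ w_ℓ = 1`
  have hne : (Finset.univ : Finset ↥p.support).Nonempty := ⟨⟨hS.choose, hS.choose_spec⟩, Finset.mem_univ _⟩
  have hmax1 : ∀ m, (Finset.univ : Finset ↥p.support).sup' hne (nmv m) = 1 := by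
    intro m
    refine le_antisymm (Finset.sup'_le _ _ fun d _ => hnmv1 m d) ?_
    obtain ⟨d, hd, hdeq⟩ := exists_monom_eq_trop hp (x m)
    refine le_trans (le_of_eq ?_) (Finset.le_sup' (nmv m) (Finset.mem_univ ⟨d, hd⟩))
    rw [hnmv, hdeq, div_self (htrop m).ne']
  have hsupw : (Finset.univ : Finset ↥p.support).sup' hne w = 1 := by
    have h1 : Tendsto (fun m => (Finset.univ : Finset ↥p.support).sup' hne (nmv (φ m))) atTop
        (𝓝 ((Finset.univ : Finset ↥p.support).sup' hne w)) :=
      Tendsto.finset_sup'_nhds_apply hne fun d _ => hwd d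
    have h2 : (fun m => (Finset.univ : Finset ↥p.support).sup' hne (nmv (φ m))) = fun _ => (1 : ℝ) :=
      funext fun m => hmax1 (φ m)
    rw [h2] at h1
    exact tendsto_nhds_unique h1 tendsto_const_nhds
  obtain ⟨d₀, -, hd₀⟩ := Finset.exists_mem_eq_sup' hne w
  have hwd₀ : w d₀ = 1 := by rw [← hd₀, hsupw]
  -- the support of the limit
  let F : Set ↥p.support := {d | 0 < w d}
  have hd₀F : d₀ ∈ F := by show 0 < w d₀; rw [hwd₀]; exact one_pos
  have hwF : ∀ d, d ∉ F → w d = 0 := fun d hd => le_antisymm (not_lt.mp hd) (hw0 d)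
  have hwF' : ∀ d ∈ F, 0 < w d := fun d hd => hd
  obtain ⟨P, projSet_apply⟩ := projSet F
  -- (c) logarithmic coordinates along the subsequence: `x (φ m) = e^{yv m}`
  obtain ⟨yv, hyv⟩ : ∃ yv : ℕ → σ → ℝ, ∀ m i, yv m i = Real.log (x (φ m) i) := ⟨_, fun _ _ => rfl⟩
  have hexp_y : ∀ m, (fun i => exp (yv m i)) = x (φ m) :=
    fun m => funext fun i => by rw [hyv, Real.exp_log (hxpos _ i)]
  -- `v m = (⟨yv m, ℓ⟩ − faceValue)_ℓ = log nmv (φ m)` (Proposition 7)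
  obtain ⟨v, hv⟩ : ∃ v : ℕ → ↥p.support → ℝ, ∀ m d, v m d = pairing (yv m) d.1 - faceValue p (yv m) :=
    ⟨_, fun _ _ => rfl⟩
  have hv_exp : ∀ m d, exp (v m d) = nmv (φ m) d := by
    intro m d
    rw [hv, Real.exp_sub, ← trop_exp hp, ← monom_exp, hexp_y, hnmv]
  have hv_log : ∀ m d, v m d = Real.log (nmv (φ m) d) := fun m d => by rw [← hv_exp, Real.log_exp]
  have hvL : ∀ m, v m ∈ LinearMap.range (affMap) := fun m =>
    LinearMap.mem_range.mpr ⟨(yv m, -faceValue p (yv m)), funext fun d => by rw [affMap_apply, hv]; ring⟩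
  -- coordinates on the face converge, coordinates off the face go to `−∞`
  have hv_F : ∀ d ∈ F, Tendsto (fun m => v m d) atTop (𝓝 (Real.log (w d))) := by
    intro d hd
    simp only [hv_log]
    exact ((Real.continuousAt_log (hwF' d hd).ne').tendsto).comp (hwd d)
  have hv_nF : ∀ d, d ∉ F → Tendsto (fun m => v m d) atTop atBot := by
    intro d hd
    simp only [hv_log]
    have h0 : Tendsto (fun m => nmv (φ m) d) atTop (𝓝[>] 0) := by
      have := hwd d
      rw [hwF d hd] at this
      exact tendsto_nhdsWithin_iff.mpr ⟨this, Eventually.of_forall fun m => hnmvpos _ _⟩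
    exact Real.tendsto_log_nhdsGT_zero.comp h0
  -- (d) Step 1: the face coordinates of the limit are the restriction of an affine functional
  --     (closedness of the finite-dimensional space of such restrictions)
  obtain ⟨lw, hlw⟩ : ∃ lw : ↥p.support → ℝ, ∀ d, lw d = F.indicator (fun d => Real.log (w d)) d := ⟨_, fun _ => rfl⟩
  have hPv_tend : Tendsto (fun m => P (v m)) atTop (𝓝 lw) := by
    rw [tendsto_pi_nhds]
    intro d
    by_cases hd : d ∈ F
    · simp only [projSet_apply, hlw, Set.indicator_of_mem hd]
      exact hv_F d hd
    · simp only [projSet_apply, hlw, Set.indicator_of_notMem hd]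
      exact tendsto_const_nhds
  have hVclosed : IsClosed (((LinearMap.range (affMap)).map P :
      Submodule ℝ (↥p.support → ℝ)) : Set (↥p.support → ℝ)) :=
    Submodule.closed_of_finiteDimensional _
  have hlwV : lw ∈ (LinearMap.range (affMap)).map P :=
    hVclosed.mem_of_tendsto hPv_tend (Eventually.of_forall fun m => Submodule.mem_map_of_mem (hvL m))
  obtain ⟨u, huL, hu⟩ := Submodule.mem_map.mp hlwV
  obtain ⟨⟨ys, cs⟩, hys⟩ := LinearMap.mem_range.mp huL
  have hys_F : ∀ d ∈ F, pairing ys d.1 + cs = Real.log (w d) := by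
    intro d hd
    have := congr_fun hu d
    rw [projSet_apply, Set.indicator_of_mem hd, ← hys, affMap_apply, hlw, Set.indicator_of_mem hd] at this
    exact this
  -- (e) Step 2: an exposing functional for `F` — push the off-face coordinates to `−∞` keeping the face coordinates `0`,
  --     using a linear right inverse of the restriction map (the role of Lemma 12's margin)
  let χ : ((σ → ℝ) × ℝ) →ₗ[ℝ] (↥p.support → ℝ) := P ∘ₗ affMap
  obtain ⟨g, hg⟩ := χ.rangeRestrict.exists_rightInverse_of_surjective χ.range_rangeRestrict
  have hχg : ∀ z : ↥(LinearMap.range χ), χ (g z) = (z : ↥p.support → ℝ) := fun z =>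
    congrArg Subtype.val (LinearMap.congr_fun hg z)
  obtain ⟨e, he⟩ : ∃ e : ℕ → (σ → ℝ) × ℝ, ∀ m, e m = (yv m, -faceValue p (yv m)) - (ys, cs) := ⟨_, fun _ => rfl⟩
  have hBe : ∀ m, affMap (e m) = v m - u := fun m => by
    rw [he, map_sub, hys]
    congr 1
    funext d
    rw [affMap_apply, hv]
    ring
  have hb_val : ∀ m, (χ.rangeRestrict (e m) : ↥p.support → ℝ) = P (v m) - lw := fun m => by
    show χ (e m) = _
    simp only [χ, LinearMap.comp_apply, hBe, map_sub, hu]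
  have hb_tend : Tendsto (fun m => χ.rangeRestrict (e m)) atTop (𝓝 0) := by
    rw [tendsto_subtype_rng]
    simp only [hb_val, ZeroMemClass.coe_zero]
    rw [← sub_self lw]
    exact hPv_tend.sub tendsto_const_nhds
  have hcont : Continuous (affMap ∘ₗ g) := LinearMap.continuous_of_finiteDimensional _
  have hcorr_tend : Tendsto (fun m => affMap (g (χ.rangeRestrict (e m)))) atTop (𝓝 0) := by
    have := (hcont.tendsto 0).comp hb_tend
    rw [map_zero] at this
    exact this
  obtain ⟨D, hD⟩ : ∃ D : ℕ → ↥p.support → ℝ, ∀ m, D m = affMap (e m - g (χ.rangeRestrict (e m))) :=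
    ⟨_, fun _ => rfl⟩
  have hPD : ∀ m, P (D m) = 0 := fun m => by
    have h2 : χ (g (χ.rangeRestrict (e m))) = χ (e m) := (hχg _).trans rfl
    calc P (D m) = χ (e m) - χ (g (χ.rangeRestrict (e m))) := by rw [hD, map_sub, map_sub]; rfl
      _ = 0 := by rw [h2, sub_self]
  have hD_coord : ∀ m d, D m d = v m d - u d - (affMap (g (χ.rangeRestrict (e m)))) d := fun m d => by
    rw [hD, map_sub, hBe]
    rfl
  have hD_bot : ∀ d, d ∉ F → Tendsto (fun m => D m d) atTop atBot := by
    intro d hd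
    have h2 : Tendsto (fun m => (affMap (g (χ.rangeRestrict (e m)))) d) atTop (𝓝 0) := by
      have := tendsto_pi_nhds.mp hcorr_tend d
      simpa using this
    have h3 : Tendsto (fun m => v m d + (-(u d) - (affMap (g (χ.rangeRestrict (e m)))) d)) atTop atBot :=
      (hv_nF d hd).atBot_add (tendsto_const_nhds.sub h2)
    simp only [hD_coord]
    exact h3.congr fun m => by ring
  have hev : ∀ᶠ m in atTop, ∀ d : ↥p.support, d ∉ F → D m d < 0 := by
    rw [Filter.eventually_all]
    intro d
    by_cases hd : d ∈ F
    · exact Eventually.of_forall fun m hnd => (hnd hd).elim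
    · exact ((hD_bot d hd).eventually (eventually_lt_atBot 0)).mono fun m hm _ => hm
  obtain ⟨m₀, hm₀⟩ := hev.exists
  obtain ⟨yy, cc, hyc⟩ : ∃ (yy : σ → ℝ) (cc : ℝ), affMap (yy, cc) = D m₀ :=
    ⟨(e m₀ - g (χ.rangeRestrict (e m₀))).1, (e m₀ - g (χ.rangeRestrict (e m₀))).2, by rw [hD]⟩
  have hDF : ∀ d ∈ F, pairing yy d.1 + cc = 0 := fun d hd => by
    have := congr_fun (hPD m₀) d
    rw [projSet_apply, Set.indicator_of_mem hd, ← hyc, affMap_apply] at this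
    exact this
  have hDnF : ∀ d : ↥p.support, d ∉ F → pairing yy d.1 + cc < 0 := fun d hd => by
    have := hm₀ d hd
    rwa [← hyc, affMap_apply] at this
  -- `⟨yy,·⟩` attains its maximum `−cc` over `supp p` exactly on `F`: the face `F_{yy}` is `F`
  have hfv : faceValue p yy = -cc := by
    rw [faceValue_of_ne_zero hp]
    refine le_antisymm (Finset.sup'_le _ _ fun d hd => ?_) ?_
    · by_cases hdF : (⟨d, hd⟩ : ↥p.support) ∈ F
      · linarith [hDF _ hdF]
      · linarith [hDnF _ hdF]
    · have := hDF d₀ hd₀F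
      calc -cc = pairing yy d₀.1 := by linarith
        _ ≤ _ := Finset.le_sup' (pairing yy) d₀.2
  have hface : ∀ d : ↥p.support, pairing yy d.1 = faceValue p yy ↔ d ∈ F := by
    intro d
    rw [hfv]
    constructor
    · intro hEq
      by_contra hdF
      have := hDnF d hdF
      linarith
    · intro hdF
      linarith [hDF d hdF]
  -- (f) the truncation to that face vanishes at the positive point `e^{ys}`: contradiction
  refine h yy (fun i => exp (ys i)) (fun i => exp_pos _) ?_
  rw [eval_trunc, Finset.sum_filter, ← Finset.sum_coe_sort]
  trans ∑ d : ↥p.support, exp (-cs) * (p.coeff d.1 * w d)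
  · refine Finset.sum_congr rfl fun d _ => ?_
    split_ifs with hc
    · have hdF : d ∈ F := (hface d).mp hc
      have hlog : pairing ys d.1 = Real.log (w d) - cs := by linarith [hys_F d hdF]
      rw [monom_exp, hlog, Real.exp_sub, Real.exp_log (hwF' d hdF), Real.exp_neg]
      field_simp
    · have hdF : d ∉ F := fun hdF => hc ((hface d).mpr hdF)
      rw [hwF d hdF]
      ring
  · rw [← Finset.mul_sum, hsumw, mul_zero]

/-! ### The printed converse and the packaging -/

/-- The converse of Theorem 8b ("the existence of such a lower bound is also necessary for a polynomial to be completely non-vanishing, which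
can be proven using a similar argument"): if `C·p^tr ≤ |p|` on `ℝ^n_{>0}` for some `C > 0`, then no truncation `p_F` has a zero in
`ℝ^n_{>0}` — along the ray `e^{t+λy}` out of a zero `e^t` of `p_{F_y}` the face part vanishes (Lemma 10) and the remaining monomials are
exponentially smaller than `p^tr`. [cite: Borinsky2020, §3.2 (tropical.tex l.477–478); Lemma 10] -/
theorem completelyNonVanishing_of_exists_pos_mul_trop_le {p : MvPolynomial σ ℝ} (hp : p ≠ 0)
    (hC : ∃ C : ℝ, 0 < C ∧ ∀ x : σ → ℝ, (∀ i, 0 < x i) → C * trop p x ≤ |eval x p|) :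
    CompletelyNonVanishing p {x | ∀ i, 0 < x i} := by
  classical
  obtain ⟨C, hC0, hC⟩ := hC
  intro y x₀ hx₀ h0
  -- logarithmic coordinates of the zero and the ray `xr r = e^{t + r y}`
  obtain ⟨t, ht⟩ : ∃ t : σ → ℝ, (fun i => exp (t i)) = x₀ :=
    ⟨fun i => Real.log (x₀ i), funext fun i => Real.exp_log (hx₀ i)⟩
  obtain ⟨xr, hxr⟩ : ∃ xr : ℝ → σ → ℝ, ∀ r, xr r = fun i => exp (t i + r * y i) := ⟨_, fun _ => rfl⟩
  have hxr_pos : ∀ r i, 0 < xr r i := fun r i => by rw [hxr]; exact exp_pos _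
  have hmono : ∀ d r, monom d (xr r) = exp (pairing t d + r * pairing y d) := fun d r => by
    rw [hxr, monom_exp, pairing_add_smul]
  -- the face part of `p(xr r)` is `e^{r·faceValue} p_F(x₀) = 0`
  have hF0 : ∀ r, ∑ d ∈ p.support.filter (fun d => pairing y d = faceValue p y), p.coeff d * monom d (xr r) = 0 := by
    intro r
    have : ∑ d ∈ p.support.filter (fun d => pairing y d = faceValue p y), p.coeff d * monom d (xr r)
        = exp (r * faceValue p y) * eval x₀ (trunc p y) := by
      rw [eval_trunc, Finset.mul_sum]
      refine Finset.sum_congr rfl fun d hd => ?_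
      rw [hmono, (Finset.mem_filter.mp hd).2, ← ht, monom_exp, Real.exp_add]
      ring
    rw [this, h0, mul_zero]
  have heval : ∀ r, eval (xr r) p = ∑ d ∈ p.support.filter (fun d => ¬ pairing y d = faceValue p y),
      p.coeff d * exp (pairing t d + r * pairing y d) := by
    intro r
    rw [eval_eq_sum_coeff_mul_monom,
      ← Finset.sum_filter_add_sum_filter_not p.support (fun d => pairing y d = faceValue p y), hF0 r, zero_add]
    exact Finset.sum_congr rfl fun d _ => by rw [hmono]
  by_cases hG : p.support.filter (fun d => ¬ pairing y d = faceValue p y) = ∅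
  · -- only the face: `p(xr 0) = 0 < C p^tr(xr 0)`
    have h1 := hC (xr 0) (hxr_pos 0)
    rw [heval 0, hG, Finset.sum_empty, abs_zero] at h1
    exact absurd h1 (not_le.mpr (mul_pos hC0 (trop_pos (hxr_pos 0) hp)))
  · set G := p.support.filter (fun d => ¬ pairing y d = faceValue p y) with hGdef
    have hGne : G.Nonempty := Finset.nonempty_of_ne_empty hG
    -- the gap `δ = faceValue − M' > 0` below the face
    set M' := G.sup' hGne (pairing y) with hM'def
    have hM'lt : M' < faceValue p y := by
      rw [hM'def, Finset.sup'_lt_iff]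
      intro d hd
      obtain ⟨hdS, hneq⟩ := Finset.mem_filter.mp hd
      exact lt_of_le_of_ne (pairing_le_faceValue hdS y) hneq
    -- `|p(xr r)| ≤ K e^{r M'}` for `r ≥ 0`
    have hbound : ∀ r, 0 ≤ r → |eval (xr r) p| ≤ (∑ d ∈ G, |p.coeff d| * exp (pairing t d)) * exp (r * M') := by
      intro r hr
      rw [heval r, Finset.sum_mul]
      refine (Finset.abs_sum_le_sum_abs _ _).trans (Finset.sum_le_sum fun d hd => ?_)
      rw [abs_mul, abs_of_pos (exp_pos _), Real.exp_add, ← mul_assoc]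
      refine mul_le_mul_of_nonneg_left (Real.exp_le_exp.mpr ?_) (mul_nonneg (abs_nonneg _) (exp_pos _).le)
      exact mul_le_mul_of_nonneg_left (Finset.le_sup' (pairing y) hd) hr
    set K := ∑ d ∈ G, |p.coeff d| * exp (pairing t d) with hKdef
    have hK0 : 0 ≤ K := Finset.sum_nonneg fun d _ => mul_nonneg (abs_nonneg _) (exp_pos _).le
    -- `p^tr(xr r) ≥ e^{⟨t,ℓ₁⟩ + r·faceValue}` for a vertex `ℓ₁` of the face
    obtain ⟨d₁, hd₁S, hd₁⟩ := exists_pairing_eq_faceValue hp y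
    have htrop_ge : ∀ r, exp (pairing t d₁ + r * faceValue p y) ≤ trop p (xr r) := fun r => by
      rw [← hd₁, ← hmono]
      exact monom_le_trop hd₁S _
    -- choose `r` with `e^{rδ} > A`, `A · C e^{⟨t,ℓ₁⟩} = K`
    have hCe : 0 < C * exp (pairing t d₁) := mul_pos hC0 (exp_pos _)
    set A := K / (C * exp (pairing t d₁)) with hAdef
    have hA0 : 0 ≤ A := div_nonneg hK0 hCe.le
    have hAK : A * (C * exp (pairing t d₁)) = K := div_mul_cancel₀ K hCe.ne'
    have hδ : 0 < faceValue p y - M' := sub_pos.mpr hM'lt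
    set r := A / (faceValue p y - M') with hrdef
    have hr0 : 0 ≤ r := div_nonneg hA0 hδ.le
    have hexp : A < exp (r * (faceValue p y - M')) := by
      have hrA : r * (faceValue p y - M') = A := div_mul_cancel₀ A hδ.ne'
      rw [hrA]
      linarith [Real.add_one_le_exp A]
    have h4 : K * exp (r * M') < C * exp (pairing t d₁ + r * faceValue p y) := by
      have e1 : C * exp (pairing t d₁ + r * faceValue p y)
          = (C * exp (pairing t d₁)) * exp (r * M') * exp (r * (faceValue p y - M')) := by
        rw [show pairing t d₁ + r * faceValue p y = pairing t d₁ + r * M' + r * (faceValue p y - M') by ring,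
          Real.exp_add, Real.exp_add]
        ring
      rw [e1, ← hAK]
      have hpos : 0 < (C * exp (pairing t d₁)) * exp (r * M') := mul_pos hCe (exp_pos _)
      calc A * (C * exp (pairing t d₁)) * exp (r * M') = A * ((C * exp (pairing t d₁)) * exp (r * M')) := by ring
        _ < exp (r * (faceValue p y - M')) * ((C * exp (pairing t d₁)) * exp (r * M')) :=
          mul_lt_mul_of_pos_right hexp hpos
        _ = _ := by ring
    have h1 := hC (xr r) (hxr_pos r)
    have h2 := hbound r hr0
    have h3 := mul_le_mul_of_nonneg_left (htrop_ge r) hC0.le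
    linarith

/-- Packaging of Theorem 8b with its printed converse: for `p ≠ 0`, `p` is completely non-vanishing on `ℝ^n_{>0}` iff
`∃ C > 0, C·p^tr(x) ≤ |p(x)|` for all `x ∈ ℝ^n_{>0}` ([SturmfelsTelek2025] Lemma 5.3: "strictly positive on each positive torus orbit",
i.e. in the interior of the copositive cone up to a global sign, for real coefficients).
[cite: Borinsky2020, Theorem 8b and §3.2 (tropical.tex l.455–478)] [cite: SturmfelsTelek2025, Lemma 5.3] -/
theorem completelyNonVanishing_iff_exists_pos_mul_trop_le {p : MvPolynomial σ ℝ} (hp : p ≠ 0) :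
    CompletelyNonVanishing p {x | ∀ i, 0 < x i} ↔
      ∃ C : ℝ, 0 < C ∧ ∀ x : σ → ℝ, (∀ i, 0 < x i) → C * trop p x ≤ |eval x p| :=
  ⟨exists_pos_mul_trop_le_abs_eval p, completelyNonVanishing_of_exists_pos_mul_trop_le hp⟩

/-- **Theorem 8** (both halves) under complete non-vanishing: `C₁ p^tr(x) ≤ |p(x)| ≤ C₂ p^tr(x)` on `ℝ^n_{>0}` with `C₁, C₂ > 0`
(`C₂ = Σ_ℓ |c_ℓ| + 1` from Theorem 8a's printed constant) — "p^tr … provides a lower and an upper bound of p with appropriate prefactors, as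
long as p is completely non-vanishing". [cite: Borinsky2020, Theorem 8 (tropical.tex l.443–475)] -/
theorem exists_two_sided_trop_bound (p : MvPolynomial σ ℝ) (h : CompletelyNonVanishing p {x | ∀ i, 0 < x i}) :
    ∃ C₁ C₂ : ℝ, 0 < C₁ ∧ 0 < C₂ ∧ ∀ x : σ → ℝ, (∀ i, 0 < x i) →
      C₁ * trop p x ≤ |eval x p| ∧ |eval x p| ≤ C₂ * trop p x := by
  obtain ⟨C₁, hC₁, h₁⟩ := exists_pos_mul_trop_le_abs_eval p h
  have hsum : 0 ≤ sumAbsCoeff p := Finset.sum_nonneg fun d _ => abs_nonneg _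
  refine ⟨C₁, sumAbsCoeff p + 1, hC₁, by linarith, fun x hx => ⟨h₁ x hx, ?_⟩⟩
  have hp : p ≠ 0 := by
    rintro rfl
    exact h 0 (fun _ => 1) (fun _ => one_pos) (by simp [trunc])
  have := abs_eval_le_sumAbsCoeff_mul_trop p (fun i => (hx i).le)
  nlinarith [trop_pos hx hp]

/-! ### The residual `R_{a/b}` is bounded (proof of Theorem 3; the hypothesis of Proposition 20 / Algorithm 2) -/

/-- `p^tr ≥ 0` on the closed positive orthant. [folklore] -/
private theorem trop_nonneg'' {x : σ → ℝ} (hx : ∀ i, 0 ≤ x i) (p : MvPolynomial σ ℝ) : 0 ≤ trop p x := by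
  by_cases hp : p = 0
  · simp [hp, trop]
  · obtain ⟨d, hd, h⟩ := exists_monom_eq_trop hp x
    rw [← h]
    exact monom_nonneg'' hx d

/-- One NUMERATOR factor of `|R_{a/b}|`: `|a(x)|^ν / a^tr(x)^ν ≤ (Σ_ℓ |c_ℓ|)^ν` on `ℝ^n_{>0}` for `ν ≥ 0` — Theorem 8a raised to the power `ν`
(for `a = 0` both sides are read with Lean's `0/0 = 0`, `0^0 = 1`). [cite: Borinsky2020, Theorem 8a (tropical.tex l.446–453); eq. (def_residualab) (l.849–851)] -/
theorem abs_eval_rpow_div_trop_rpow_le (p : MvPolynomial σ ℝ) {ν : ℝ} (hν : 0 ≤ ν) {x : σ → ℝ} (hx : ∀ i, 0 < x i) :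
    |eval x p| ^ ν / trop p x ^ ν ≤ sumAbsCoeff p ^ ν := by
  by_cases hp : p = 0
  · subst hp
    have hS : sumAbsCoeff (0 : MvPolynomial σ ℝ) = 0 := by simp [sumAbsCoeff]
    by_cases hν0 : ν = 0
    · simp [hν0]
    · simp [trop, hS, Real.zero_rpow hν0]
  have ht : 0 < trop p x := trop_pos hx hp
  have hS0 : 0 ≤ sumAbsCoeff p := Finset.sum_nonneg fun d _ => abs_nonneg _
  rw [div_le_iff₀ (Real.rpow_pos_of_pos ht ν), ← Real.mul_rpow hS0 ht.le]
  exact Real.rpow_le_rpow (abs_nonneg _) (abs_eval_le_sumAbsCoeff_mul_trop p fun i => (hx i).le) hν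

/-- One DENOMINATOR factor of `|R_{a/b}|`: if `C·b^tr ≤ |b|` on `ℝ^n_{>0}` (Theorem 8b's conclusion for a completely non-vanishing `b`), then
`C^ρ ≤ |b(x)|^ρ / b^tr(x)^ρ` there for `ρ ≥ 0`. [cite: Borinsky2020, Theorem 8b (tropical.tex l.455–459); eq. (def_residualab) (l.849–851)] -/
theorem rpow_le_abs_eval_rpow_div_trop_rpow {p : MvPolynomial σ ℝ} (hp : p ≠ 0) {C ρ : ℝ} (hC : 0 ≤ C) (hρ : 0 ≤ ρ)
    {x : σ → ℝ} (hx : ∀ i, 0 < x i) (hCx : C * trop p x ≤ |eval x p|) :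
    C ^ ρ ≤ |eval x p| ^ ρ / trop p x ^ ρ := by
  have ht : 0 < trop p x := trop_pos hx hp
  rw [le_div_iff₀ (Real.rpow_pos_of_pos ht ρ), ← Real.mul_rpow hC ht.le]
  exact Real.rpow_le_rpow (mul_nonneg hC ht.le) hCx hρ

/-- **The residual is bounded** (the one sentence of the proof of Theorem 3 that uses Theorem 8: "As all the denominator polynomials {b_j}
are completely non-vanishing, Corollary 9 implies that |R_{a/b}(x)| is bounded on ℙ^{n−1}_{>0}."; also the hypothesis "As |R_{a/b}(x)| is
bounded" of Proposition 20's proof and of the companion file `TropicalSamplingEstimator.lean`, which records it as not typed there). Typed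
for the MODULUS of eq. (def_residualab), `|R_{a/b}(x)| = (Π_i |a_i(x)|^{ν_i}/a_i^tr(x)^{ν_i}) / (Π_j |b_j(x)|^{ρ_j}/b_j^tr(x)^{ρ_j})`, with
REAL exponents `ν_i, ρ_j ≥ 0` (the paper: complex ν, ρ with the tropical powers carrying Re ν_i, Re ρ_j, which are the non-negative weights of
the Minkowski sums 𝒜, ℬ of Theorem 3 — TODO(general form): complex exponents, |a^ν| = |a|^{Re ν} for a > 0), finitely many factors, the
numerators `a_i` arbitrary and every denominator `b_j` completely non-vanishing on `ℝ^n_{>0}` (requirement R3; R1–R2 are not needed for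
boundedness). The bound is `C = Π_i (Σ_ℓ|c_ℓ(a_i)|)^{ν_i} / Π_j C_j^{ρ_j}` with `C_j` the Theorem-8b constants.
[cite: Borinsky2020, proof of Theorem 3 (tropical.tex l.855–858); eq. (def_residualab) (l.849–853); proof of Proposition 20 (l.864–867)] -/
theorem exists_abs_residual_le {ι κ : Type*} [Fintype ι] [Fintype κ]
    (a : ι → MvPolynomial σ ℝ) (b : κ → MvPolynomial σ ℝ) (ν : ι → ℝ) (ρ : κ → ℝ)
    (hν : ∀ i, 0 ≤ ν i) (hρ : ∀ j, 0 ≤ ρ j) (hb : ∀ j, CompletelyNonVanishing (b j) {x | ∀ i, 0 < x i}) :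
    ∃ C : ℝ, 0 ≤ C ∧ ∀ x : σ → ℝ, (∀ i, 0 < x i) →
      (∏ i, |eval x (a i)| ^ ν i / trop (a i) x ^ ν i) / (∏ j, |eval x (b j)| ^ ρ j / trop (b j) x ^ ρ j) ≤ C := by
  classical
  have hc : ∀ j, ∃ c : ℝ, 0 < c ∧ ∀ x : σ → ℝ, (∀ i, 0 < x i) → c * trop (b j) x ≤ |eval x (b j)| :=
    fun j => exists_pos_mul_trop_le_abs_eval (b j) (hb j)
  choose c hc0 hcb using hc
  have hbne : ∀ j, b j ≠ 0 := fun j h0 => by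
    have := hb j 0 (fun _ => 1) (fun _ => one_pos)
    simp [h0, trunc] at this
  have hN0 : 0 ≤ ∏ i, sumAbsCoeff (a i) ^ ν i :=
    Finset.prod_nonneg fun i _ => Real.rpow_nonneg (Finset.sum_nonneg fun d _ => abs_nonneg _) _
  have hD0 : 0 < ∏ j, c j ^ ρ j := Finset.prod_pos fun j _ => Real.rpow_pos_of_pos (hc0 j) _
  refine ⟨(∏ i, sumAbsCoeff (a i) ^ ν i) / ∏ j, c j ^ ρ j, div_nonneg hN0 hD0.le, fun x hx => ?_⟩
  have hnum : ∏ i, |eval x (a i)| ^ ν i / trop (a i) x ^ ν i ≤ ∏ i, sumAbsCoeff (a i) ^ ν i :=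
    Finset.prod_le_prod (fun i _ => div_nonneg (Real.rpow_nonneg (abs_nonneg _) _)
      (Real.rpow_nonneg (trop_nonneg'' (fun k => (hx k).le) _) _))
      fun i _ => abs_eval_rpow_div_trop_rpow_le (a i) (hν i) hx
  have hden : ∏ j, c j ^ ρ j ≤ ∏ j, |eval x (b j)| ^ ρ j / trop (b j) x ^ ρ j :=
    Finset.prod_le_prod (fun j _ => (Real.rpow_pos_of_pos (hc0 j) _).le)
      fun j _ => rpow_le_abs_eval_rpow_div_trop_rpow (hbne j) (hc0 j).le (hρ j) hx (hcb j x hx)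
  exact div_le_div₀ hN0 hnum hD0 hden

end Literature.MathematicalPhysics.QuantumFieldTheory.Borinsky2020

end
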